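import Literature.Probability.RandomPlanarGeometry.TwoSidedWholePlaneSLEStationarity
import HarnessLib

/-!
# Self-similarity of two-sided whole-plane SLE_κ (Zhan (2021), Cor. 4.7): reductions and the corrected statement

Topic `Probability/RandomPlanarGeometry`; sequel to `TwoSidedWholePlaneSLE` and
`TwoSidedWholePlaneSLEStationarity`, accompanying the named fact
`IsTwoSidedWholePlaneSLENatLaw.map_dilatePath` ("`γ̂₀` is a self-similar process of index `1/d`",
Zhan (2021), Cor. 4.7, `d = 1 + κ/8`). Zhan's printed proof is one sentence — "the self-similarity of
`γ̂₀` follows easily from the scaling invariance of `ν^#_{∞⇌0}` and the scaling covariance of the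
Minkowski content measure" — and presupposes that `ν^#_{∞⇌0}` is ONE law. Formally it factors as
(closure) the class of natural laws is closed under the dilations `dilatePath (1/d) a`, `a > 0`
(scaling covariance of Minkowski content: `IsNaturallyParametrized.dilatePath`, proved in
`NaturalParametrization`; scale covariance of the first arm: `IsWholePlaneSLEKappaRho.const_mul_comp_sub_log`,
proved in `WholePlaneSLEScaling`; of the remaining domain: `armComplement_const_mul_comp_sub` below;
of the uniformizer and the chordal arm) plus (well-definedness) two laws in the class coincide.

* **The statement is corrected, not discharged.** As recorded in `TwoSidedWholePlaneSLEStationarity`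
  (module docstring and `IsTwoSidedWholePlaneSLEPairMeas`), the pair predicate
  `IsTwoSidedWholePlaneSLEPair` underlying `IsTwoSidedWholePlaneSLENatLaw` allows a NON-MEASURABLE
  selector `Φ` of the uniformizer of the remaining domain; on a suitably enlarged probability space
  the dilation factor hidden in `Φ(η₁)` can be made a.s. equal to a functional of the driving path
  `W` (and of `η₁`), so that — granted existence of the two-sided curve — the class
  `{μ | IsTwoSidedWholePlaneSLENatLaw κ μ}` contains laws other than Zhan's `ν̂^#_{∞⇌0}`; choosing the
  factor to depend on `W` and on a scale-sensitive functional of `η₁` (e.g. `2` on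
  `{W(1) > 0} ∩ {|η₁(0)| > 1}`, `1` elsewhere) produces such a law that is NOT self-similar. Hence
  `IsTwoSidedWholePlaneSLENatLaw.map_dilatePath` is stronger than the source. The corrected statement
  is the same conclusion over the measurably uniformized class `IsTwoSidedWholePlaneSLENatLawMeas`
  (there the conditional law of the second arm given the first is chordal SLE_κ whatever the
  selector, by the dilation invariance of the chordal trace law); it is recorded here as the
  CONCLUSION of the proved implication `IsTwoSidedWholePlaneSLENatLaw.map_dilatePath_imp_meas`
  (the misstated fact implies the corrected one, the corrected class being smaller), exactly as
  `…map_reroot_imp_meas` does for stationarity; and it is vendored as the named fact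
  `IsTwoSidedWholePlaneSLENatLawMeas.map_dilatePath` (last section: the RESTATEMENT of the misstated
  fact, same source and locator, decided by the review of that fact), with the proved links
  `IsTwoSidedWholePlaneSLENatLaw.map_dilatePath_imp_natLawMeas` (misstated ⇒ restated),
  `IsTwoSidedWholePlaneSLENatLawMeas.isSelfSimilar` and `…map_dilatePath_of_unique_of_closed'`.
* **Reductions, proved.** `map_dilatePath_meas_iff_closed_of_unique`: granted well-definedness of the
  corrected law, corrected self-similarity is exactly the closure of the corrected class under the
  dilations (`…of_unique_of_closed`, converse `closed_of_map_dilatePath_meas`) — the formal content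
  of "the scaling invariance of `ν^#_{∞⇌0}`". `dilatePath_dilatePath`, `map_dilatePath_inv_of_map`:
  the dilations form a group action on paths and on laws. `isSelfSimilar_of_map_dilatePath_meas`,
  `isRerootInvariant_of_map_dilatePath_meas_of_map_reroot_one`: how the two halves of Cor. 4.7
  assemble on the corrected class (with `TwoSidedWholePlaneSLEStationarity`).
* `armComplement_const_mul_comp_sub`: the remaining domain of the dilated, re-timed arm is the
  dilate of the remaining domain (`Loewner.image_mul_unboundedComponent`).

What is NOT here. The closure of the corrected class under dilations needs, besides the proved
ingredients above, that the arm uniformizer `φ` have a boundary value at every real point the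
chordal trace visits (`ConformalEquiv.boundaryExtension = extendFrom` takes an unspecified constant
value where no limit exists, and that constant does not scale): the continuity theorem for conformal
maps onto domains with locally connected boundary (Pommerenke (1992), Thm 2.1) and the local
connectivity of the boundary of the unbounded complementary component of the arm — not in the tree;
and the well-definedness of the corrected law (uniqueness of the stationary angle law and of the
whole-plane Loewner chain, tips determined by hulls, dilation invariance of the chordal trace law).

## References

* D. Zhan, *SLE loop measures*, PTRF 179 (2021), arXiv:1702.08026 (arXiv numbering): §2.1–2.2,
  Cor. 4.7 and its proof (p. 23). [Zhan2021SLELoopMeasures]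
* Ch. Pommerenke, *Boundary Behaviour of Conformal Maps* (1992), Thm 2.1. [Pommerenke1992]
-/

noncomputable section

open Set Filter Topology MeasureTheory ProbabilityTheory Complex
open scoped NNReal Real ENNReal

namespace Literature.Probability.RandomPlanarGeometry

open scoped PathBorel

/-! ### The dilations as a group action on paths and laws -/

section Dilations

/-- Dilations of two-sided paths compose multiplicatively: `D_a ∘ D_b = D_{ab}` for `a, b > 0`
(`(ab)^ν = a^ν b^ν`, `t/(ab) = (t/a)/b`). [folklore] -/
theorem dilatePath_dilatePath (ν : ℝ) {a b : ℝ} (ha : 0 < a) (hb : 0 < b) (γ : C(ℝ, ℂ)) :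
    dilatePath ν a (dilatePath ν b γ) = dilatePath ν (a * b) γ := by
  ext t
  simp only [dilatePath_apply]
  rw [Real.mul_rpow ha.le hb.le, Complex.ofReal_mul, mul_assoc, ← div_div, div_right_comm]

/-- Dilation by `a⁻¹` undoes dilation by `a` (`a > 0`). [folklore] -/
theorem dilatePath_inv_dilatePath (ν : ℝ) {a : ℝ} (ha : 0 < a) (γ : C(ℝ, ℂ)) :
    dilatePath ν a⁻¹ (dilatePath ν a γ) = γ := by
  rw [dilatePath_dilatePath ν (inv_pos.2 ha) ha, inv_mul_cancel₀ ha.ne', dilatePath_one]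

/-- A law invariant under `D_a` is invariant under `D_{a⁻¹}` (`a > 0`). [folklore] -/
theorem map_dilatePath_inv_of_map (ν : ℝ) {a : ℝ} (ha : 0 < a) {μ : Measure C(ℝ, ℂ)}
    (h : μ.map (dilatePath ν a) = μ) : μ.map (dilatePath ν a⁻¹) = μ := by
  conv_lhs => rw [← h]
  rw [Measure.map_map (measurable_dilatePath ν _) (measurable_dilatePath ν _)]
  have : dilatePath ν a⁻¹ ∘ dilatePath ν a = id := funext (dilatePath_inv_dilatePath ν ha)
  rw [this, Measure.map_id]

end Dilations

/-! ### The remaining domain of a dilated arm -/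

/-- **The remaining domain scales with the arm**: dilating (and re-timing) the first arm dilates its
remaining domain, `Ĉ(k η(· - s); ∞) = k · Ĉ(η; ∞)` (`k ≠ 0`) — the closed trace scales, and taking
the unbounded complementary component commutes with dilations
(`Loewner.image_mul_unboundedComponent`). Zhan (2021), §2.1. [folklore] -/
theorem armComplement_const_mul_comp_sub {k : ℂ} (hk : k ≠ 0) (η : ℝ → ℂ) (s : ℝ) :
    armComplement (fun t ↦ k * η (t - s)) = (fun z ↦ k * z) '' armComplement η := by
  have hbij : Function.Bijective fun z : ℂ ↦ k * z :=
    ⟨mul_right_injective₀ hk, fun w ↦ ⟨k⁻¹ * w, mul_inv_cancel_left₀ hk w⟩⟩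
  have hrange : range (fun t ↦ k * η (t - s)) = (fun z ↦ k * z) '' range η := by
    ext w
    simp only [mem_range, mem_image]
    constructor
    · rintro ⟨t, rfl⟩
      exact ⟨η (t - s), ⟨t - s, rfl⟩, rfl⟩
    · rintro ⟨_, ⟨u, rfl⟩, rfl⟩
      exact ⟨u + s, by rw [add_sub_cancel_right]⟩
  unfold armComplement
  rw [Loewner.image_mul_unboundedComponent hk, image_compl_eq hbij, image_insert_eq, mul_zero, hrange]

/-! ### The corrected statement of self-similarity, and the reductions -/

section Corrected

/-- **Self-similarity of index `1/d` of the two-sided whole-plane SLE_κ natural parametrisation —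
corrected statement, recorded as the conclusion of a proved implication.** Zhan (2021), Cor. 4.7:
"Suppose that `γ̂₀` is a Minkowski content parametrization of a two-sided whole-plane SLE_κ curve from
`∞` to `∞` passing through `0` such that `γ̂₀(0) = 0`. Then `γ̂₀` is a self-similar process of index
`1/d` defined on `ℝ`" (`κ ∈ (0, 8)`, `d = 1 + κ/8`); self-similarity of index `1/d` = invariance of
the law under `γ ↦ a^{1/d} γ(·/a)` = `dilatePath (1/d) a`, all `a > 0`. The CONCLUSION of this
theorem, `∀ κ μ, 0 < κ → κ < 8 → IsTwoSidedWholePlaneSLENatLawMeas κ μ → ∀ a > 0,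
μ.map (dilatePath (1/(1 + κ/8)) a) = μ`, is the corrected statement of the named fact
`IsTwoSidedWholePlaneSLENatLaw.map_dilatePath` (vendored below as the named fact
`IsTwoSidedWholePlaneSLENatLawMeas.map_dilatePath`, its restatement); the theorem itself only
records that the misstated fact implies the corrected one (the corrected class of laws is smaller,
`IsTwoSidedWholePlaneSLENatLawMeas.toNatLaw`). DISCREPANCY: `IsTwoSidedWholePlaneSLENatLaw.map_dilatePath`
carries the same conclusion over the larger class `IsTwoSidedWholePlaneSLENatLaw κ` (non-measurable
uniformizer selector allowed), which — granted existence of the two-sided curve — contains laws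
other than Zhan's `ν̂^#_{∞⇌0}`, some of them not self-similar (module docstring); it is thus stronger
than the source. [cite: Zhan2021SLELoopMeasures, Cor. 4.7] -/
theorem IsTwoSidedWholePlaneSLENatLaw.map_dilatePath_imp_meas
    (h47 : IsTwoSidedWholePlaneSLENatLaw.map_dilatePath) :
    ∀ (κ : ℝ≥0) (μ : Measure C(ℝ, ℂ)), 0 < κ → κ < 8 → IsTwoSidedWholePlaneSLENatLawMeas κ μ →
      ∀ a : ℝ, 0 < a → μ.map (dilatePath (1 / (1 + (κ : ℝ) / 8)) a) = μ :=
  fun κ μ hκ hκ' h ↦ h47 κ μ hκ hκ' h.toNatLaw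

/-- Corrected self-similarity makes every corrected natural law (`0 < κ < 8`) self-similar of index
`ν = 1/(1 + κ/8)` in the sense of the law predicate `IsSelfSimilar` of `NaturalParametrization`.
[cite: Zhan2021SLELoopMeasures, Cor. 4.7] -/
theorem IsTwoSidedWholePlaneSLENatLawMeas.isSelfSimilar_of_map_dilatePath_meas
    (h47 : ∀ (κ : ℝ≥0) (μ : Measure C(ℝ, ℂ)), 0 < κ → κ < 8 →
      IsTwoSidedWholePlaneSLENatLawMeas κ μ →
        ∀ a : ℝ, 0 < a → μ.map (dilatePath (1 / (1 + (κ : ℝ) / 8)) a) = μ)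
    {κ : ℝ≥0} {μ : Measure C(ℝ, ℂ)} (hκ : 0 < κ) (hκ' : κ < 8)
    (h : IsTwoSidedWholePlaneSLENatLawMeas κ μ) : IsSelfSimilar (1 / (1 + (κ : ℝ) / 8)) μ :=
  h47 κ μ hκ hκ' h

/-- **How the two halves of Cor. 4.7 assemble on the corrected class**: corrected self-similarity
(hypothesis `h47`, the first half of Zhan (2021), Cor. 4.7) and invariance under the unit re-rooting
`𝒯₁ = reroot 1` (the SLE-loop-measure input of the second half, Zhan (2021), Thm 4.2 (iv)) give
stationary increments — Zhan's "because of the self-similarity of `γ̂₀`, it suffices to show that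
`ν̂^#_{∞⇌0}` is invariant under `𝒯₁`", via
`IsTwoSidedWholePlaneSLENatLawMeas.isRerootInvariant_of_map_reroot_one`.
[cite: Zhan2021SLELoopMeasures, Cor. 4.7] -/
theorem IsTwoSidedWholePlaneSLENatLawMeas.isRerootInvariant_of_map_dilatePath_meas_of_map_reroot_one
    (h47 : ∀ (κ : ℝ≥0) (μ : Measure C(ℝ, ℂ)), 0 < κ → κ < 8 →
      IsTwoSidedWholePlaneSLENatLawMeas κ μ →
        ∀ a : ℝ, 0 < a → μ.map (dilatePath (1 / (1 + (κ : ℝ) / 8)) a) = μ)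
    {κ : ℝ≥0} {μ : Measure C(ℝ, ℂ)} (hκ : 0 < κ) (hκ' : κ < 8)
    (h : IsTwoSidedWholePlaneSLENatLawMeas κ μ)
    (h1 : μ.map (RootedCurve.reroot 1) = μ) : IsRerootInvariant μ :=
  h.isRerootInvariant_of_map_reroot_one (h47 κ μ hκ hκ' h) h1

/-- **"Scaling invariance of `ν^#_{∞⇌0}`", formal content (corrected class).** Granted the
well-definedness of the corrected natural law (hypothesis `hu`: two corrected natural laws for the
same `κ` coincide — the corrected form of `IsTwoSidedWholePlaneSLENatLaw.unique`), corrected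
self-similarity follows from the closure of the corrected class under the dilations
`dilatePath (1/d) a`, `a > 0` (hypothesis `hcl`: the dilate of a corrected natural law is again one —
scaling covariance of Minkowski content, `IsNaturallyParametrized.dilatePath`, and scale covariance
of the two arms and of the uniformizer): both `μ.map (dilatePath (1/d) a)` and `μ` are corrected
natural laws, hence equal. This is the sentence "the self-similarity of `γ̂₀` follows easily from the
scaling invariance of `ν^#_{∞⇌0}` and the scaling covariance of the Minkowski content measure" of the
proof of Zhan (2021), Cor. 4.7. [cite: Zhan2021SLELoopMeasures, Cor. 4.7] -/
theorem IsTwoSidedWholePlaneSLENatLawMeas.map_dilatePath_of_unique_of_closed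
    (hu : ∀ (κ : ℝ≥0) (μ μ' : Measure C(ℝ, ℂ)),
      IsTwoSidedWholePlaneSLENatLawMeas κ μ → IsTwoSidedWholePlaneSLENatLawMeas κ μ' → μ = μ')
    (hcl : ∀ (κ : ℝ≥0) (μ : Measure C(ℝ, ℂ)), 0 < κ → κ < 8 →
      IsTwoSidedWholePlaneSLENatLawMeas κ μ →
        ∀ a : ℝ, 0 < a → IsTwoSidedWholePlaneSLENatLawMeas κ (μ.map (dilatePath (1 / (1 + (κ : ℝ) / 8)) a))) :
    ∀ (κ : ℝ≥0) (μ : Measure C(ℝ, ℂ)), 0 < κ → κ < 8 → IsTwoSidedWholePlaneSLENatLawMeas κ μ →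
      ∀ a : ℝ, 0 < a → μ.map (dilatePath (1 / (1 + (κ : ℝ) / 8)) a) = μ :=
  fun κ μ hκ hκ' h a ha ↦ hu κ _ _ (hcl κ μ hκ hκ' h a ha) h

/-- Conversely, corrected self-similarity contains the closure of the corrected class under the
dilations (the dilate of a corrected natural law IS that law). [cite: Zhan2021SLELoopMeasures, Cor. 4.7] -/
theorem IsTwoSidedWholePlaneSLENatLawMeas.closed_of_map_dilatePath_meas
    (h47 : ∀ (κ : ℝ≥0) (μ : Measure C(ℝ, ℂ)), 0 < κ → κ < 8 →
      IsTwoSidedWholePlaneSLENatLawMeas κ μ →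
        ∀ a : ℝ, 0 < a → μ.map (dilatePath (1 / (1 + (κ : ℝ) / 8)) a) = μ)
    (κ : ℝ≥0) (μ : Measure C(ℝ, ℂ)) (hκ : 0 < κ) (hκ' : κ < 8)
    (h : IsTwoSidedWholePlaneSLENatLawMeas κ μ) (a : ℝ) (ha : 0 < a) :
    IsTwoSidedWholePlaneSLENatLawMeas κ (μ.map (dilatePath (1 / (1 + (κ : ℝ) / 8)) a)) := by
  rwa [h47 κ μ hκ hκ' h a ha]

/-- Granted well-definedness of the corrected law, corrected self-similarity is EQUIVALENT to the
closure of the corrected class under the dilations `dilatePath (1/d) a`, `a > 0`.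
[cite: Zhan2021SLELoopMeasures, Cor. 4.7] -/
theorem IsTwoSidedWholePlaneSLENatLawMeas.map_dilatePath_meas_iff_closed_of_unique
    (hu : ∀ (κ : ℝ≥0) (μ μ' : Measure C(ℝ, ℂ)),
      IsTwoSidedWholePlaneSLENatLawMeas κ μ → IsTwoSidedWholePlaneSLENatLawMeas κ μ' → μ = μ') :
    (∀ (κ : ℝ≥0) (μ : Measure C(ℝ, ℂ)), 0 < κ → κ < 8 → IsTwoSidedWholePlaneSLENatLawMeas κ μ →
        ∀ a : ℝ, 0 < a → μ.map (dilatePath (1 / (1 + (κ : ℝ) / 8)) a) = μ) ↔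
      ∀ (κ : ℝ≥0) (μ : Measure C(ℝ, ℂ)), 0 < κ → κ < 8 → IsTwoSidedWholePlaneSLENatLawMeas κ μ →
        ∀ a : ℝ, 0 < a →
          IsTwoSidedWholePlaneSLENatLawMeas κ (μ.map (dilatePath (1 / (1 + (κ : ℝ) / 8)) a)) :=
  ⟨IsTwoSidedWholePlaneSLENatLawMeas.closed_of_map_dilatePath_meas,
    IsTwoSidedWholePlaneSLENatLawMeas.map_dilatePath_of_unique_of_closed hu⟩

/-- It suffices to check the closure for dilation factors `a > 1` (or any generating set): if the
corrected class is closed under `D_a` for all `a > 1` and the corrected law is well defined, it is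
closed under all `D_a`, `a > 0` — `D_{a⁻¹}`-invariance follows from `D_a`-invariance
(`map_dilatePath_inv_of_map`). [folklore] -/
theorem IsTwoSidedWholePlaneSLENatLawMeas.map_dilatePath_of_unique_of_closed_one_lt
    (hu : ∀ (κ : ℝ≥0) (μ μ' : Measure C(ℝ, ℂ)),
      IsTwoSidedWholePlaneSLENatLawMeas κ μ → IsTwoSidedWholePlaneSLENatLawMeas κ μ' → μ = μ')
    (hcl : ∀ (κ : ℝ≥0) (μ : Measure C(ℝ, ℂ)), 0 < κ → κ < 8 →
      IsTwoSidedWholePlaneSLENatLawMeas κ μ →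
        ∀ a : ℝ, 1 < a → IsTwoSidedWholePlaneSLENatLawMeas κ (μ.map (dilatePath (1 / (1 + (κ : ℝ) / 8)) a))) :
    ∀ (κ : ℝ≥0) (μ : Measure C(ℝ, ℂ)), 0 < κ → κ < 8 → IsTwoSidedWholePlaneSLENatLawMeas κ μ →
      ∀ a : ℝ, 0 < a → μ.map (dilatePath (1 / (1 + (κ : ℝ) / 8)) a) = μ := by
  intro κ μ hκ hκ' h a ha
  have hgt : ∀ b : ℝ, 1 < b → μ.map (dilatePath (1 / (1 + (κ : ℝ) / 8)) b) = μ :=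
    fun b hb ↦ hu κ _ _ (hcl κ μ hκ hκ' h b hb) h
  rcases lt_trichotomy a 1 with ha1 | rfl | ha1
  · have hinv : 1 < a⁻¹ := (one_lt_inv₀ ha).2 ha1
    simpa only [inv_inv] using map_dilatePath_inv_of_map _ (inv_pos.2 ha) (hgt a⁻¹ hinv)
  · have : dilatePath (1 / (1 + (κ : ℝ) / 8)) 1 = (id : C(ℝ, ℂ) → C(ℝ, ℂ)) :=
      funext (dilatePath_one _)
    rw [this, Measure.map_id]
  · exact hgt a ha1

end Corrected

/-! ### The named fact, restated over the measurably uniformized class -/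

section NamedFact

/-- **Self-similarity of index `1/d` of the two-sided whole-plane SLE_κ natural parametrisation**
(named fact — the corrected statement of `IsTwoSidedWholePlaneSLENatLaw.map_dilatePath` of
`TwoSidedWholePlaneSLE`, restated over the measurably uniformized class of laws). Zhan (2021),
Cor. 4.7: "Suppose that `γ̂₀` is a Minkowski content parametrization of a two-sided whole-plane SLE_κ
curve from `∞` to `∞` passing through `0` such that `γ̂₀(0) = 0`. Then `γ̂₀` is a self-similar
process of index `1/d` defined on `ℝ` with stationary increments" — here its first half,
self-similarity (`κ ∈ (0, 8)` and `d = 1 + κ/8` are the standing conventions of Zhan (2021), §2: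
"Throughout, we fix `κ ∈ (0, 8)`. Let `d = 1 + κ/8`" — the Minkowski content dimension of SLE_κ,
Lawler–Rezaei (2015), Thm 1.1); printed proof (p. 23 of the arXiv version): "The self-similarity
of `γ̂₀` follows easily from the scaling invariance of `ν^#_{∞⇌0}` and the scaling covariance of the
Minkowski content measure". Self-similarity of index
`1/d` of the law `μ` of `γ̂₀` is the invariance of `μ` under `γ ↦ a^{1/d} γ(· / a)`, i.e. under
`dilatePath (1/d) a`, for every `a > 0` (the law predicate `IsSelfSimilar (1/d) μ` of
`NaturalParametrization`). The law `μ` ranges over `IsTwoSidedWholePlaneSLENatLawMeas κ`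
(`TwoSidedWholePlaneSLEStationarity`): the laws of the Minkowski content parametrisation rooted at
`0` of a two-sided whole-plane SLE_κ curve from `∞` to `∞` through `0` whose second arm is, given the
first, chordal SLE_κ in the remaining domain through a MEASURABLY selected uniformizer — the class
on which Zhan's kernel definition of the single law `ν^#_{∞⇌0}` (§2.2) is represented faithfully.
WHY A RESTATEMENT: the original `IsTwoSidedWholePlaneSLENatLaw.map_dilatePath` carries this same
conclusion over the larger class `IsTwoSidedWholePlaneSLENatLaw κ` (non-measurable selector
allowed), which, granted existence of the curve, contains laws that are not self-similar (module
docstring) — it is stronger than the source and implies this fact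
(`IsTwoSidedWholePlaneSLENatLaw.map_dilatePath_imp_natLawMeas`). Not discharged here: by
`map_dilatePath_of_unique_of_closed'` it follows from the well-definedness of the corrected law and
the closure of the corrected class under the dilations (Zhan's "scaling invariance of `ν^#_{∞⇌0}`"),
whose missing inputs are listed in the module docstring ("What is NOT here"). [cite: Zhan2021SLELoopMeasures, Cor. 4.7] -/
def IsTwoSidedWholePlaneSLENatLawMeas.map_dilatePath : Prop :=
  ∀ (κ : ℝ≥0) (μ : Measure C(ℝ, ℂ)), 0 < κ → κ < 8 → IsTwoSidedWholePlaneSLENatLawMeas κ μ →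
    ∀ a : ℝ, 0 < a → μ.map (dilatePath (1 / (1 + (κ : ℝ) / 8)) a) = μ

/-- The misstated fact `IsTwoSidedWholePlaneSLENatLaw.map_dilatePath` (same conclusion over the
larger, non-measurably uniformized class) implies its restatement
`IsTwoSidedWholePlaneSLENatLawMeas.map_dilatePath` (this is `…map_dilatePath_imp_meas`).
[cite: Zhan2021SLELoopMeasures, Cor. 4.7] -/
theorem IsTwoSidedWholePlaneSLENatLaw.map_dilatePath_imp_natLawMeas
    (h47 : IsTwoSidedWholePlaneSLENatLaw.map_dilatePath) :
    IsTwoSidedWholePlaneSLENatLawMeas.map_dilatePath :=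
  IsTwoSidedWholePlaneSLENatLaw.map_dilatePath_imp_meas h47

/-- Given the restated Cor. 4.7 (hypothesis `h47`), every corrected two-sided whole-plane SLE_κ
natural law (`0 < κ < 8`) is self-similar of index `ν = 1/(1 + κ/8)` (`IsSelfSimilar`).
[cite: Zhan2021SLELoopMeasures, Cor. 4.7] -/
theorem IsTwoSidedWholePlaneSLENatLawMeas.isSelfSimilar
    (h47 : IsTwoSidedWholePlaneSLENatLawMeas.map_dilatePath) {κ : ℝ≥0} {μ : Measure C(ℝ, ℂ)}
    (hκ : 0 < κ) (hκ' : κ < 8) (h : IsTwoSidedWholePlaneSLENatLawMeas κ μ) :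
    IsSelfSimilar (1 / (1 + (κ : ℝ) / 8)) μ :=
  h47 κ μ hκ hκ' h

/-- Given the restated Cor. 4.7 (hypothesis `h47`, self-similarity) and invariance under the unit
re-rooting `𝒯₁ = reroot 1` (the SLE-loop-measure input of the second half of Cor. 4.7), a corrected
natural law has stationary increments (Zhan's reduction "because of the self-similarity of `γ̂₀`, it
suffices to show that `ν̂^#_{∞⇌0}` is invariant under `𝒯₁`"). [cite: Zhan2021SLELoopMeasures, Cor. 4.7] -/
theorem IsTwoSidedWholePlaneSLENatLawMeas.isRerootInvariant_of_map_dilatePath_of_map_reroot_one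
    (h47 : IsTwoSidedWholePlaneSLENatLawMeas.map_dilatePath) {κ : ℝ≥0} {μ : Measure C(ℝ, ℂ)}
    (hκ : 0 < κ) (hκ' : κ < 8) (h : IsTwoSidedWholePlaneSLENatLawMeas κ μ)
    (h1 : μ.map (RootedCurve.reroot 1) = μ) : IsRerootInvariant μ :=
  h.isRerootInvariant_of_map_reroot_one (h47 κ μ hκ hκ' h) h1

/-- **Zhan's one-line proof, as a reduction of the restated fact**: granted the well-definedness of
the corrected natural law (`hu`) and the closure of the corrected class under the dilations
`dilatePath (1/d) a`, `a > 1` (`hcl` — "the scaling invariance of `ν^#_{∞⇌0}` and the scaling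
covariance of the Minkowski content measure"), the restated Cor. 4.7 holds
(`map_dilatePath_of_unique_of_closed_one_lt`). [cite: Zhan2021SLELoopMeasures, Cor. 4.7] -/
theorem IsTwoSidedWholePlaneSLENatLawMeas.map_dilatePath_of_unique_of_closed'
    (hu : ∀ (κ : ℝ≥0) (μ μ' : Measure C(ℝ, ℂ)),
      IsTwoSidedWholePlaneSLENatLawMeas κ μ → IsTwoSidedWholePlaneSLENatLawMeas κ μ' → μ = μ')
    (hcl : ∀ (κ : ℝ≥0) (μ : Measure C(ℝ, ℂ)), 0 < κ → κ < 8 →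
      IsTwoSidedWholePlaneSLENatLawMeas κ μ →
        ∀ a : ℝ, 1 < a → IsTwoSidedWholePlaneSLENatLawMeas κ (μ.map (dilatePath (1 / (1 + (κ : ℝ) / 8)) a))) :
    IsTwoSidedWholePlaneSLENatLawMeas.map_dilatePath :=
  IsTwoSidedWholePlaneSLENatLawMeas.map_dilatePath_of_unique_of_closed_one_lt hu hcl

/-- Conversely the restated fact makes the corrected class closed under all the dilations
`dilatePath (1/d) a`, `a > 0` (the dilate of a corrected natural law is that law).
[cite: Zhan2021SLELoopMeasures, Cor. 4.7] -/
theorem IsTwoSidedWholePlaneSLENatLawMeas.map_dilatePath.closed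
    (h47 : IsTwoSidedWholePlaneSLENatLawMeas.map_dilatePath) (κ : ℝ≥0) (μ : Measure C(ℝ, ℂ))
    (hκ : 0 < κ) (hκ' : κ < 8) (h : IsTwoSidedWholePlaneSLENatLawMeas κ μ) (a : ℝ) (ha : 0 < a) :
    IsTwoSidedWholePlaneSLENatLawMeas κ (μ.map (dilatePath (1 / (1 + (κ : ℝ) / 8)) a)) :=
  IsTwoSidedWholePlaneSLENatLawMeas.closed_of_map_dilatePath_meas h47 κ μ hκ hκ' h a ha

end NamedFact

end Literature.Probability.RandomPlanarGeometry
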